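import Mathlib
import HarnessLib

/-!
# Linear charts on the base plane: Tonelli with an affine substitution in the second variable

(Line `janus-bands`, crux `ArrangementNormalForm`, stub `stub_separateTwo`, part `Chart`.)
The measure-theoretic bookkeeping that turns the pointwise fibre-mass comparisons of the
`stub_separateTwo` roadmap (ANGULAR: thin sector against good sector at a fixed abscissa; RADIAL:
a point against the far end of its ray through a rational point) into integral inequalities on
the base plane `ℝ² = (Fin 2 → ℝ)`: for measurable `b, c : ℝ → ℝ` with `c ≠ 0` on `I`,
`∫⁻_{x ∈ I, (y − b x)/c x ∈ J} G = ∫⁻_{x ∈ I} |c x| ∫⁻_{v ∈ J} G(x, b x + c x · v)`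
(`lintegral_chart`, registered as `separateTwo_chart`). Rays through `P`: `b x = y_P`,
`c x = x − x_P`; thin/good sectors: `J` an interval of slopes. Ingredients: `finTwoArrow`
(`ℝ² ≃ᵐ ℝ × ℝ`, measure preserving), Tonelli, and the one-variable change of variables
`lintegral_image_eq_lintegral_abs_deriv_mul` for the affine map `v ↦ b + c v`
(`lintegral_affine_image`).
-/

noncomputable section

open Set MeasureTheory
open scoped ENNReal

namespace Summit.KontsevichZagierPeriods.ArrangementNormalForm.JanusBands

namespace SepTwo

/-- The image of a set under `v ↦ b + c v`, `c ≠ 0`. -/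
theorem affine_image {b c : ℝ} (hc : c ≠ 0) (J : Set ℝ) :
    (fun v => b + c * v) '' J = {y | (y - b) / c ∈ J} := by
  ext y
  constructor
  · rintro ⟨v, hv, rfl⟩
    simpa [hc] using hv
  · intro hy
    exact ⟨(y - b) / c, hy, by field_simp; ring⟩

/-- **One-variable affine change of variables** in a lower integral. -/
theorem lintegral_affine_image {b c : ℝ} (hc : c ≠ 0) {J : Set ℝ} (hJ : MeasurableSet J)
    (H : ℝ → ℝ≥0∞) :
    ∫⁻ y in {y | (y - b) / c ∈ J}, H y = ENNReal.ofReal |c| * ∫⁻ v in J, H (b + c * v) := by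
  rw [← affine_image hc J]
  have hder : ∀ v ∈ J, HasDerivWithinAt (fun v => b + c * v) c J v := fun v _ => by
    simpa using ((hasDerivAt_id v).const_mul c).const_add b |>.hasDerivWithinAt
  have hinj : InjOn (fun v => b + c * v) J := fun v _ w _ h => by
    simpa [hc] using h
  rw [lintegral_image_eq_lintegral_abs_deriv_mul hJ hder hinj H,
    lintegral_const_mul' _ _ ENNReal.ofReal_ne_top]

/-- The chart domain in `ℝ × ℝ` is measurable. -/
theorem measurableSet_chartProd {I J : Set ℝ} (hI : MeasurableSet I) (hJ : MeasurableSet J)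
    {b c : ℝ → ℝ} (hb : Measurable b) (hc : Measurable c) :
    MeasurableSet {p : ℝ × ℝ | p.1 ∈ I ∧ (p.2 - b p.1) / c p.1 ∈ J} := by
  refine (measurable_fst hI).inter ?_
  exact ((measurable_snd.sub (hb.comp measurable_fst)).div (hc.comp measurable_fst)) hJ

/-- **Tonelli in a linear chart** (product form). -/
theorem lintegral_chartProd {I J : Set ℝ} (hI : MeasurableSet I) (hJ : MeasurableSet J)
    {b c : ℝ → ℝ} (hb : Measurable b) (hc : Measurable c) (hc0 : ∀ x ∈ I, c x ≠ 0)
    (G : ℝ × ℝ → ℝ≥0∞) (hG : Measurable G) :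
    ∫⁻ p in {p : ℝ × ℝ | p.1 ∈ I ∧ (p.2 - b p.1) / c p.1 ∈ J}, G p =
      ∫⁻ x in I, ENNReal.ofReal |c x| * ∫⁻ v in J, G (x, b x + c x * v) := by
  set E := {p : ℝ × ℝ | p.1 ∈ I ∧ (p.2 - b p.1) / c p.1 ∈ J} with hE
  have hEm : MeasurableSet E := measurableSet_chartProd hI hJ hb hc
  rw [Measure.volume_eq_prod, ← lintegral_indicator hEm,
    lintegral_prod _ (hG.indicator hEm).aemeasurable, ← lintegral_indicator hI]
  refine lintegral_congr fun x => ?_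
  by_cases hx : x ∈ I
  · rw [indicator_of_mem hx]
    have h3 : (fun y => E.indicator G (x, y)) =
        {y | (y - b x) / c x ∈ J}.indicator fun y => G (x, y) := by
      funext y
      by_cases hy : (y - b x) / c x ∈ J
      · rw [indicator_of_mem (show (x, y) ∈ E from ⟨hx, hy⟩),
          indicator_of_mem (show y ∈ {y | (y - b x) / c x ∈ J} from hy)]
      · rw [indicator_of_notMem (show (x, y) ∉ E from fun h => hy h.2),
          indicator_of_notMem (show y ∉ {y | (y - b x) / c x ∈ J} from hy)]
    have hm : MeasurableSet {y | (y - b x) / c x ∈ J} :=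
      ((measurable_id.sub_const _).div_const _) hJ
    rw [h3, lintegral_indicator hm, lintegral_affine_image (hc0 x hx) hJ]
  · rw [indicator_of_notMem hx]
    have h3 : ∀ y, E.indicator G (x, y) = 0 := fun y => indicator_of_notMem (fun h => hx h.1) _
    simp [h3]

/-- **Tonelli in a linear chart** on `Fin 2 → ℝ`. See the module docstring. -/
theorem lintegral_chart {I J : Set ℝ} (hI : MeasurableSet I) (hJ : MeasurableSet J)
    {b c : ℝ → ℝ} (hb : Measurable b) (hc : Measurable c) (hc0 : ∀ x ∈ I, c x ≠ 0)
    (G : (Fin 2 → ℝ) → ℝ≥0∞) (hG : Measurable G) :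
    ∫⁻ z in {z : Fin 2 → ℝ | z 0 ∈ I ∧ (z 1 - b (z 0)) / c (z 0) ∈ J}, G z =
      ∫⁻ x in I, ENNReal.ofReal |c x| * ∫⁻ v in J, G ![x, b x + c x * v] := by
  set e := (MeasurableEquiv.finTwoArrow : (Fin 2 → ℝ) ≃ᵐ ℝ × ℝ) with he
  set E := {p : ℝ × ℝ | p.1 ∈ I ∧ (p.2 - b p.1) / c p.1 ∈ J} with hE
  have hpre : e ⁻¹' E = {z : Fin 2 → ℝ | z 0 ∈ I ∧ (z 1 - b (z 0)) / c (z 0) ∈ J} := by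
    ext z; simp [he, hE, MeasurableEquiv.finTwoArrow_apply]
  have hG' : Measurable fun p : ℝ × ℝ => G (e.symm p) := hG.comp e.symm.measurable
  have h1 := (volume_preserving_finTwoArrow ℝ).setLIntegral_comp_preimage_emb e.measurableEmbedding
    (fun p => G (e.symm p)) E
  rw [hpre] at h1
  have h2 : (fun z : Fin 2 → ℝ => G (e.symm (e z))) = G := funext fun z => by rw [e.symm_apply_apply]
  rw [h2] at h1
  have hsymm : ∀ p : ℝ × ℝ, e.symm p = ![p.1, p.2] := fun p => by
    rw [he, MeasurableEquiv.finTwoArrow_symm_apply]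
    ext i
    fin_cases i <;> rfl
  rw [h1, lintegral_chartProd hI hJ hb hc hc0 _ hG']
  simp only [hsymm]

end SepTwo

/-- **Tonelli in a linear chart of the base plane** (registered sub-goal of `stub_separateTwo`;
literal form of `SepTwo.lintegral_chart`). -/
theorem separateTwo_chart (I J : Set ℝ) (hI : MeasurableSet I) (hJ : MeasurableSet J) (b c : ℝ → ℝ) (hb : Measurable b) (hc : Measurable c) (hc0 : ∀ x ∈ I, c x ≠ 0) (G : (Fin 2 → ℝ) → ENNReal) (hG : Measurable G) : MeasureTheory.lintegral (MeasureTheory.volume.restrict {z : Fin 2 → ℝ | z 0 ∈ I ∧ (z 1 - b (z 0)) / c (z 0) ∈ J}) G = MeasureTheory.lintegral (MeasureTheory.volume.restrict I) (fun x => ENNReal.ofReal |c x| * MeasureTheory.lintegral (MeasureTheory.volume.restrict J) (fun v => G ![x, b x + c x * v])) := by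
  exact SepTwo.lintegral_chart hI hJ hb hc hc0 G hG

end Summit.KontsevichZagierPeriods.ArrangementNormalForm.JanusBands
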